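import Summits.HodgeConjecture.HodgeConjecture.Theses.HeightMassDefect
import Literature.AlgebraicGeometry.HodgeTheory.HodgeSectionRestrictionOfCupPairing
import Literature.AlgebraicGeometry.HodgeTheory.HodgeIndexPrimitiveAlgebraicHolds
import Literature.AlgebraicGeometry.HodgeTheory.LefschetzOneOneHolds
import Literature.AlgebraicGeometry.HodgeTheory.SaitoGrFDeRhamCurveNetHolds
import Literature.AlgebraicGeometry.Resolution.ProjectiveResolutionProofs
import HarnessLib

/-!
# Route HeightMassDefect — support item `SectionRestrictionSurface` (stmt-HodgeConjecture-2517), PROVED;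
# and the landing pads `SectionRestrictionFourfold` / `SectionRestriction` from the Hodge conjecture

**Calibration `m = 0` (Kerr–Pearlstein 2011, Example 43).** Every non-zero rational `(1,1)`-class `c`
on a smooth projective complex surface `X ⊂ ℙⁿ` (embedding `e`) restricts non-trivially to some
hypersurface section `Z = X ∩ V₊(F)`, `deg F = k ≥ 1`, `Z ≠ X`:
`heightMassDefect_sectionRestrictionSurface_proof`, whose type is literally the route decl
`Summit.HodgeConjecture.HodgeConjecture.Theses.HeightMassDefect.SectionRestrictionSurface`.

Proof = the printed one, every input now a THEOREM of the tree: the Hodge index theorem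
(`hodgeIndex_surface_holds`) and Lefschetz `(1,1)` (`lefschetzOneOne_rational_holds`) give a divisor
class `d` with `c ∪ d ≠ 0` (`exists_cup_ne_zero_of_hodgeIndex`); Deligne's Hodge III Cor. 8.2.8
(`Deligne1974_ker_restrictCompl_eq_iSup_range_complexGysin_holds`) and resolution of the supporting
curves (`Resolution.Hironaka1964_projective_holds`) turn "`c ∪ [C] ≠ 0`" into "`c|_C ≠ 0`" through the
projection formula, and Lemma 49 of Brosnan–Fang–Nie–Pearlstein (`exists_forall_le_form_vanishing_of_notMem`,
proved) puts `C` on a hypersurface section of every large degree not containing `X` — all assembled in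
the tree's `forall_le_sectionRestriction_surface_of_hodgeIndex_of_gysinKernel`
(file `HodgeSectionRestrictionGysinKernel`), which this file merely feeds with the four discharges. The
stronger ALL-LARGE-DEGREES form is recorded as `heightMassDefect_sectionRestrictionSurface_forall_le`.

The same assembly in dimension `2n` (BFNP 2009, §6 Lemma 50:
`forall_le_exists_sectionRestriction_ne_zero_of_cupPairing_of_gysinKernel`, fed with the perfect pairing
(6.1) `hardLefschetz_hodgeRiemann_holds.hodgeClasses_cupPairing_nondegenerate`) gives the two sanity
implications the route's docstrings assert ("HC ⟹ it by Hodge–Riemann + Bertini-type containment"):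
`heightMassDefect_sectionRestrictionFourfold_of_hodgeConjectureFor` (crux `SectionRestrictionFourfold`,
stmt-HodgeConjecture-2514, from HC for the fourfold in question) and
`heightMassDefect_sectionRestriction_of_hodgeConjecture` (crux `SectionRestriction`,
stmt-HodgeConjecture-2515, from `HodgeConjecture`). No definition, no named-fact hypothesis, no sorry.
-/

noncomputable section

-- every declaration of this problem lives in `Summit.HodgeConjecture.HodgeConjecture.…` (summit = sub-problem)
set_option linter.dupNamespace false

namespace Summit.HodgeConjecture.HodgeConjecture.Theorems

open CategoryTheory AlgebraicGeometry
open Literature.AlgebraicGeometry Literature.AlgebraicGeometry.Motives Literature.AlgebraicGeometry.HodgeTheory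
open Literature.AlgebraicTopology.SingularHomology
open Summit.HodgeConjecture.HodgeConjecture.Theses.HeightMassDefect
  (SectionRestrictionSurface SectionRestrictionFourfold SectionRestriction)

/-- **Calibration `m = 0` in ALL LARGE DEGREES** (Kerr–Pearlstein 2011, Example 43; BFNP 2009 §6,
Lemma 50 with Lemma 49): for a smooth projective surface `X` with projective embedding `e` and a
non-zero rational `(1,1)`-class `c ∈ H²(X(ℂ); ℂ)` there is `k₀ ≥ 1` such that for EVERY `k ≥ k₀` some
hypersurface section `Z = e⁻¹ V₊(F) ≠ X`, `F` homogeneous of degree `k`, has `c|_{Z(ℂ)} ≠ 0`.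
Unconditional: the tree's `forall_le_sectionRestriction_surface_of_hodgeIndex_of_gysinKernel` fed with
`hodgeIndex_surface_holds`, `lefschetzOneOne_rational_holds`,
`Deligne1974_ker_restrictCompl_eq_iSup_range_complexGysin_holds`, `Resolution.Hironaka1964_projective_holds`.
[cite: KerrPearlstein2011, Example 43] [cite: BrosnanFangNiePearlstein2009, §6 Lemma 49 and Lemma 50]
[cite: DeligneHodgeIII1974, Cor. 8.2.8] -/
theorem heightMassDefect_sectionRestrictionSurface_forall_le ⦃X : SchemeOver ℂ⦄
    (hX : IsSmoothProjective 2 X) (e : ProjectiveEmbedding X) (c : complexBetti X 2)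
    (hc : IsRationalClass c) (h11 : IsOfHodgeType 2 X 2 1 1 c) (hne : c ≠ 0) :
    ∃ k₀ : ℕ, 0 < k₀ ∧ ∀ k : ℕ, k₀ ≤ k →
      ∃ (F : MvPolynomial (Fin (e.n + 1)) ℂ) (Z : Set X.left), F.IsHomogeneous k ∧
        Z = e.ι.left.base ⁻¹' (letI := MvPolynomial.gradedAlgebra (σ := Fin (e.n + 1)) (R := ℂ);
          ProjectiveSpectrum.zeroLocus (MvPolynomial.homogeneousSubmodule (Fin (e.n + 1)) ℂ) {F}) ∧
        Z ≠ Set.univ ∧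
        singularCohomology.map ℂ ℂ
          (⟨Subtype.val, continuous_subtype_val⟩ :
            C({P : ComplexPoints X // P.pt ∈ Z}, ComplexPoints X)) 2 c ≠ 0 :=
  forall_le_sectionRestriction_surface_of_hodgeIndex_of_gysinKernel hodgeIndex_surface_holds
    lefschetzOneOne_rational_holds Deligne1974_ker_restrictCompl_eq_iSup_range_complexGysin_holds
    Resolution.Hironaka1964_projective_holds hX e c hc h11 hne

/-- **Item stmt-HodgeConjecture-2517 (`SectionRestrictionSurface`, route `HeightMassDefect`), PROVED**:
every non-zero rational `(1,1)`-class on a smooth projective complex surface `X ⊂ ℙⁿ` restricts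
non-trivially to some curve section `Z = X ∩ V₊(F)`, `deg F ≥ 1`, `Z ≠ X` (Kerr–Pearlstein 2011,
Example 43) — the degree `k₀` of `heightMassDefect_sectionRestrictionSurface_forall_le`. The type is
literally the route decl `Summit.HodgeConjecture.HodgeConjecture.Theses.HeightMassDefect.SectionRestrictionSurface`.
[cite: KerrPearlstein2011, Example 43] [cite: BrosnanFangNiePearlstein2009, §6 Lemma 50]
[cite: VoisinHodgeI2002, Thm. 6.32 and Thm. 11.30] -/
theorem heightMassDefect_sectionRestrictionSurface_proof : SectionRestrictionSurface := by
  intro X hX e c hc h11 hne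
  obtain ⟨k₀, hk₀, hk⟩ := heightMassDefect_sectionRestrictionSurface_forall_le hX e c hc h11 hne
  obtain ⟨F, Z, hF, hZ, hZu, hcZ⟩ := hk k₀ le_rfl
  exact ⟨k₀, F, Z, hk₀, hF, hZ, hZu, hcZ⟩

/-- **BFNP Lemma 50 in ALL LARGE DEGREES, unconditionally in the facts**: for a smooth projective
`2n`-fold `X` (`n ≥ 1`) satisfying `HodgeConjectureFor (2n) X`, every non-zero rational `(n,n)`-class
restricts non-trivially to some hypersurface section of every large degree. The tree's
`forall_le_exists_sectionRestriction_ne_zero_of_cupPairing_of_gysinKernel` fed with Deligne's Cor. 8.2.8,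
Hironaka, and the perfect pairing (6.1) from the proved Kähler package
(`hardLefschetz_hodgeRiemann_holds.hodgeClasses_cupPairing_nondegenerate`).
[cite: BrosnanFangNiePearlstein2009, §6 (6.1), Lemma 49 and Lemma 50] [cite: DeligneHodgeIII1974, Cor. 8.2.8]
[cite: VoisinHodgeI2002, Thm. 6.32] -/
theorem sectionRestriction_forall_le_of_hodgeConjectureFor {n : ℕ} ⦃X : SchemeOver ℂ⦄ (hn : 0 < n)
    (hX : IsSmoothProjective (2 * n) X) (hHC : HodgeConjectureFor (2 * n) X)
    (e : ProjectiveEmbedding X) (c : complexBetti X (2 * n)) (hc : IsRationalClass c)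
    (hH : IsOfHodgeType (2 * n) X (2 * n) n n c) (hne : c ≠ 0) :
    ∃ k₀ : ℕ, 0 < k₀ ∧ ∀ k : ℕ, k₀ ≤ k →
      ∃ (F : MvPolynomial (Fin (e.n + 1)) ℂ) (Z : Set X.left), F.IsHomogeneous k ∧
        Z = e.ι.left.base ⁻¹' (letI := MvPolynomial.gradedAlgebra (σ := Fin (e.n + 1)) (R := ℂ);
          ProjectiveSpectrum.zeroLocus (MvPolynomial.homogeneousSubmodule (Fin (e.n + 1)) ℂ) {F}) ∧
        Z ≠ Set.univ ∧
        singularCohomology.map ℂ ℂ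
          (⟨Subtype.val, continuous_subtype_val⟩ :
            C({P : ComplexPoints X // P.pt ∈ Z}, ComplexPoints X)) (2 * n) c ≠ 0 :=
  forall_le_exists_sectionRestriction_ne_zero_of_cupPairing_of_gysinKernel
    Deligne1974_ker_restrictCompl_eq_iSup_range_complexGysin_holds Resolution.Hironaka1964_projective_holds
    hn hX hHC hardLefschetz_hodgeRiemann_holds.hodgeClasses_cupPairing_nondegenerate e c hc hH hne

/-- **HC for a fourfold ⟹ the landing pad `SectionRestrictionFourfold` for it** (crux
stmt-HodgeConjecture-2514 is implied by the Hodge conjecture for fourfolds — "HC ⟹ it by HR +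
Bertini-type containment", as the item's docstring asserts; this direction only). For a smooth
projective fourfold `X` with `HodgeConjectureFor 4 X`, every non-zero rational `(2,2)`-class restricts
non-trivially to some hypersurface section. [cite: BrosnanFangNiePearlstein2009, §6 (6.1) and Lemma 50]
[cite: DeligneHodgeIII1974, Cor. 8.2.8] -/
theorem heightMassDefect_sectionRestrictionFourfold_of_hodgeConjectureFor ⦃X : SchemeOver ℂ⦄
    (hX : IsSmoothProjective 4 X) (hHC : HodgeConjectureFor 4 X) (e : ProjectiveEmbedding X)
    (c : complexBetti X 4) (hc : IsRationalClass c) (h22 : IsOfHodgeType 4 X 4 2 2 c) (hne : c ≠ 0) :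
    ∃ (k : ℕ) (F : MvPolynomial (Fin (e.n + 1)) ℂ) (Z : Set X.left), 0 < k ∧ F.IsHomogeneous k ∧
      Z = e.ι.left.base ⁻¹' (letI := MvPolynomial.gradedAlgebra (σ := Fin (e.n + 1)) (R := ℂ);
        ProjectiveSpectrum.zeroLocus (MvPolynomial.homogeneousSubmodule (Fin (e.n + 1)) ℂ) {F}) ∧
      Z ≠ Set.univ ∧
      singularCohomology.map ℂ ℂ
        (⟨Subtype.val, continuous_subtype_val⟩ :
          C({P : ComplexPoints X // P.pt ∈ Z}, ComplexPoints X)) 4 c ≠ 0 := by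
  obtain ⟨k₀, hk₀, hk⟩ :=
    sectionRestriction_forall_le_of_hodgeConjectureFor (n := 2) two_pos hX hHC e c hc h22 hne
  obtain ⟨F, Z, hF, hZ, hZu, hcZ⟩ := hk k₀ le_rfl
  exact ⟨k₀, F, Z, hk₀, hF, hZ, hZu, hcZ⟩

/-- **HC for all fourfolds ⟹ `SectionRestrictionFourfold`** (the crux stmt-HodgeConjecture-2514 BY
NAME from the Hodge conjecture in dimension `4`; the converse, `FourfoldCriterion`, is the route's open
glue). [cite: BrosnanFangNiePearlstein2009, §6 Lemma 50] -/
theorem heightMassDefect_sectionRestrictionFourfold_of_hodgeFourfolds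
    (hHC : ∀ ⦃X : SchemeOver ℂ⦄, IsSmoothProjective 4 X → HodgeConjectureFor 4 X) :
    SectionRestrictionFourfold :=
  fun _ hX e c hc h22 hne ↦
    heightMassDefect_sectionRestrictionFourfold_of_hodgeConjectureFor hX (hHC hX) e c hc h22 hne

/-- **`HodgeConjecture` ⟹ `SectionRestriction`** (the crux stmt-HodgeConjecture-2515 BY NAME from the
summit statement: "Conversely HC ⟹ SectionRestriction elementarily", as the item's docstring asserts —
BFNP Lemma 50 in every even dimension `2(m+1)`, all inputs but HC being theorems of the tree).
[cite: BrosnanFangNiePearlstein2009, §6 (6.1) and Lemma 50] [cite: KerrPearlstein2011, Conj. 41 / Thm. 42] -/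
theorem heightMassDefect_sectionRestriction_of_hodgeConjecture (hHC : _root_.HodgeConjecture) :
    SectionRestriction := by
  intro m X hX e c hc hH hne
  obtain ⟨k₀, hk₀, hk⟩ := sectionRestriction_forall_le_of_hodgeConjectureFor (n := m + 1)
    (Nat.succ_pos m) hX (hHC hX) e c hc hH hne
  obtain ⟨F, Z, hF, hZ, hZu, hcZ⟩ := hk k₀ le_rfl
  exact ⟨k₀, F, Z, hk₀, hF, hZ, hZu, hcZ⟩

end Summit.HodgeConjecture.HodgeConjecture.Theorems

end
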